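import Literature.NumberTheory.Automorphic.Zelevinsky1980.MaximalParabolicOrbitFiltration
import HarnessLib

/-!
# Endomorphisms of `Ind_{Q_{N-1,1}}^{GL_N} σ'` for a character `σ'`: scalars when the two exponents differ

Topic `NumberTheory/Automorphic/Zelevinsky1980`; theorems only (no definition, no named fact). Let `F`
be a non-archimedean local field, `P = Q_{N-1,1} ≤ GL_N(F)` (`N = n + 2`), `σ'` a smooth one-dimensional
representation of `P` (on `ℂ`) trivial on the unipotent radical `U_c`, `I = Ind_P^{GL_N} σ'`
(`Representation.smoothIndRep`), `ϖ` a uniformizer, `e = σ'(d(ϖ))` the **closed-orbit exponent** and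
`q_F · s`, `s = σ'(d₀(ϖ))`, the **open-orbit exponent** of the central element
`d(ϖ) = diag(1, …, 1, ϖ)` of the Levi on the Jacquet module `I_{U_c}`
(`JacquetOfInducedMaximalParabolic`).

* `exists_intertwiningMap_eq_smul` — **if `q_F s ≠ e` then `End_{GL_N}(I) = ℂ`**: for an
  intertwining operator `T`, the functional `λ f = (T f)(1)` is `(P, σ')`-equivariant, hence factors
  through the `U_c`-coinvariants and has `d(ϖ)`-eigenvalue `e`; on the open-cell part it has eigenvalue
  `q_F s`, so it vanishes there, hence (chart decomposition `MaximalParabolicOrbitFiltration`) on all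
  functions vanishing on `P`; therefore `λ = c · ev₁` and `T = c · id`. This is the Mackey–Bruhat
  computation `dim Hom_P(I|_P, σ') ≤ 1` (Bernstein–Zelevinsky 1977, Thm. 5.2 for the pair
  `(Q_{N-1,1}, Q_{N-1,1})`: the two orbits of §7.1 contribute `σ'` and `i ∘ w ∘ r(σ')`, and the latter
  has no `σ'`-quotient when the exponents differ).
* `isIrreducible_of_exists_isCompl` — **irreducibility from complete reducibility**: if moreover every
  subrepresentation of `I` has an invariant complement (e.g. `I` unitary and admissible) and `I ≠ 0`,
  then `I` is irreducible (a complemented subrepresentation gives an idempotent in `End_{GL_N}(I) = ℂ`).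

This is the route to Zelevinsky 1980, Thm. 4.2 for `(ν₀ ∘ det) × χ′` with unitary `ν₀, χ′`
(`ParabolicIndGLDetCharIrreducible`), where `e = χ′(ϖ) q_F^{(N-1)/2}` and `q_F s = ν₀(ϖ) q_F^{1/2}`
have different absolute values for `N ≥ 3`.

## References

* I. N. Bernstein, A. V. Zelevinsky, *Induced representations of reductive `p`-adic groups I*,
  Ann. Sci. ÉNS 10 (1977), Thm. 5.2, §7.1. [BernsteinZelevinskyASENS1977]
* A. V. Zelevinsky, *Induced representations of reductive `p`-adic groups II*, Ann. Sci. ÉNS 13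
  (1980), §1, Thm. 4.2. [Zelevinsky1980]
-/

noncomputable section

open Matrix Literature.LinearAlgebra.Matrix.DiagonalTorus

namespace Literature.NumberTheory.Automorphic.Zelevinsky1980

open ValuativeRel Valued

variable {F : Type*} [Field F] [ValuativeRel F] [TopologicalSpace F] [IsNonarchimedeanLocalField F]
  {n : ℕ} (σ' : Representation ℂ ↥(standardParabolicGL F (lastBlockLabel (n + 2))) ℂ)

omit [ValuativeRel F] [TopologicalSpace F] [IsNonarchimedeanLocalField F] in
/-- A one-dimensional representation acts by the scalars `σ'(p) 1`. [cite: Zelevinsky1980, §3.2 Example] -/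
theorem apply_eq_mul_apply_one (p : ↥(standardParabolicGL F (lastBlockLabel (n + 2)))) (z : ℂ) :
    σ' p z = σ' p 1 * z := by
  rw [mul_comm, ← smul_eq_mul, ← map_smul, smul_eq_mul, mul_one]

/-- **`End_{GL_N}(Ind_{Q_{N-1,1}}^{GL_N} σ') = ℂ` when the two exponents differ.** For a smooth
one-dimensional `σ'` trivial on `U_c` with `q_F · σ'(d₀(ϖ)) ≠ σ'(d(ϖ))`, every intertwining operator of
`I = Ind_P^{GL_N} σ'` is a scalar. [cite: BernsteinZelevinskyASENS1977, Thm. 5.2 and §7.1] -/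
theorem exists_intertwiningMap_eq_smul (hσ' : σ'.IsSmooth)
    (hU : ∀ u : ↥(standardParabolicGL F (lastBlockLabel (n + 2))), u ∈ unipotentRadicalP F (lastBlockLabel (n + 2)) →
      σ' u = 1)
    {ϖ : F} (hϖ : IsUniformizingElement ϖ)
    (hne : (GaloisRepresentations.IsNonarchimedeanLocalField.residueFieldCard F : ℂ) *
        σ' ⟨diagGL (Fin (n + 2)) (Function.update 1 0 (Units.mk0 ϖ hϖ.ne_zero)), diagGL_mem_standardParabolicGL _ _⟩ 1 ≠
      σ' ⟨diagGL (Fin (n + 2)) (Function.update 1 (Fin.last (n + 1)) (Units.mk0 ϖ hϖ.ne_zero)),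
        diagGL_mem_standardParabolicGL _ _⟩ 1)
    (T : (Representation.smoothIndRep (standardParabolicGL F (lastBlockLabel (n + 2))) σ').IntertwiningMap
      (Representation.smoothIndRep (standardParabolicGL F (lastBlockLabel (n + 2))) σ')) :
    ∃ c : ℂ, ∀ f, T f = c • f := by
  classical
  -- the functional `λ f = (T f)(1)` and its `(P, σ')`-equivariance
  set lam : Representation.SmoothInd (standardParabolicGL F (lastBlockLabel (n + 2))) σ' →ₗ[ℂ] ℂ :=
    (LinearMap.proj (1 : GL (Fin (n + 2)) F)) ∘ₗ
      (Representation.SmoothInd.toFunₗ (standardParabolicGL F (lastBlockLabel (n + 2))) σ' ∘ₗ T.toLinearMap)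
    with hlam_def
  have hlam : ∀ f, lam f = (T f).toFun 1 := fun f => rfl
  have hT : ∀ (g : GL (Fin (n + 2)) F) (f : Representation.SmoothInd (standardParabolicGL F (lastBlockLabel (n + 2))) σ'), T ((Representation.smoothIndRep (standardParabolicGL F (lastBlockLabel (n + 2))) σ') g f) = (Representation.smoothIndRep (standardParabolicGL F (lastBlockLabel (n + 2))) σ') g (T f) := fun g f => by
    have := LinearMap.congr_fun (T.isIntertwining' g) f
    exact this
  have hTval : ∀ (g : GL (Fin (n + 2)) F) (f : Representation.SmoothInd (standardParabolicGL F (lastBlockLabel (n + 2))) σ'), (T f).toFun g = lam ((Representation.smoothIndRep (standardParabolicGL F (lastBlockLabel (n + 2))) σ') g f) := by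
    intro g f
    rw [hlam, hT, Representation.toFun_smoothIndRep_apply, one_mul]
  have hlamP : ∀ (p : ↥(standardParabolicGL F (lastBlockLabel (n + 2)))) (f : Representation.SmoothInd (standardParabolicGL F (lastBlockLabel (n + 2))) σ'), lam ((Representation.smoothIndRep (standardParabolicGL F (lastBlockLabel (n + 2))) σ') (p : GL (Fin (n + 2)) F) f) = σ' p 1 * lam f := by
    intro p f
    rw [hlam, hlam, hT, Representation.toFun_smoothIndRep_apply, one_mul, ← mul_one (p : GL (Fin (n + 2)) F),
      Representation.SmoothInd.toFun_subgroup_mul, apply_eq_mul_apply_one]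
  -- `λ` factors through the `U_c`-coinvariants
  have hlamU : ∀ u : ↥(unipotentRadicalP F (lastBlockLabel (n + 2))),
      lam ∘ₗ (Representation.restrictUnipotentGL F (lastBlockLabel (n + 2)) (Representation.smoothIndRep (standardParabolicGL F (lastBlockLabel (n + 2))) σ')) u = lam := by
    intro u
    ext f
    change lam ((Representation.smoothIndRep (standardParabolicGL F (lastBlockLabel (n + 2))) σ') ((u : ↥(standardParabolicGL F (lastBlockLabel (n + 2)))) : GL (Fin (n + 2)) F) f) = lam f
    rw [hlamP, hU _ u.2, Module.End.one_apply, one_mul]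
  set lamb := Representation.Coinvariants.lift (Representation.restrictUnipotentGL F (lastBlockLabel (n + 2)) (Representation.smoothIndRep (standardParabolicGL F (lastBlockLabel (n + 2))) σ')) lam hlamU
    with hlamb_def
  have hlamb : ∀ f, lamb (Representation.Coinvariants.mk _ f) = lam f := fun f =>
    Representation.Coinvariants.lift_mk _ _ _ _
  -- the closed-orbit exponent
  set a : GL (Fin (n + 2)) F := diagGL (Fin (n + 2)) (Function.update 1 (Fin.last (n + 1)) (Units.mk0 ϖ hϖ.ne_zero)) with ha
  have haP : a ∈ standardParabolicGL F (lastBlockLabel (n + 2)) := diagGL_mem_standardParabolicGL _ _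
  have hlam_a : ∀ f, lam ((Representation.smoothIndRep (standardParabolicGL F (lastBlockLabel (n + 2))) σ') a f) = σ' ⟨a, haP⟩ 1 * lam f := fun f => hlamP ⟨a, haP⟩ f
  -- Step 1: `λ` kills the open-cell part
  have hopen : ∀ f : Representation.SmoothInd (standardParabolicGL F (lastBlockLabel (n + 2))) σ', f ∈ vanishingOn (standardParabolicGL F (lastBlockLabel (n + 2))) σ'
      (cellLT (K := F) (lastBlockLabel (n + 2)) Fin.revPerm) → lam f = 0 := by
    intro f hf
    have h1 := mk_smoothIndRep_diag_eq_smul_of_mem_vanishingOn σ' hσ' hϖ (s := σ' ⟨diagGL (Fin (n + 2))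
      (Function.update 1 0 (Units.mk0 ϖ hϖ.ne_zero)), diagGL_mem_standardParabolicGL _ _⟩ 1)
      (fun w => by rw [smul_eq_mul]; exact apply_eq_mul_apply_one σ' _ w) f hf
    have h2 := congrArg lamb h1
    rw [map_smul, hlamb, hlamb, hlam_a, smul_eq_mul] at h2
    have h3 : ((GaloisRepresentations.IsNonarchimedeanLocalField.residueFieldCard F : ℂ) *
        σ' ⟨diagGL (Fin (n + 2)) (Function.update 1 0 (Units.mk0 ϖ hϖ.ne_zero)), diagGL_mem_standardParabolicGL _ _⟩ 1 -
        σ' ⟨a, haP⟩ 1) * lam f = 0 := by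
      rw [sub_mul, ← h2, sub_self]
    exact (mul_eq_zero.1 h3).resolve_left (sub_ne_zero.2 hne)
  -- Step 2: `λ` kills every `f` vanishing on `P` (chart decomposition)
  have hclosed : ∀ f : Representation.SmoothInd (standardParabolicGL F (lastBlockLabel (n + 2))) σ', (∀ p ∈ standardParabolicGL F (lastBlockLabel (n + 2)), f.toFun p = 0) → lam f = 0 := by
    intro f hf
    obtain ⟨fi, hfi, hsum⟩ := exists_sum_smoothIndRep_swap_of_forall_toFun_eq_zero σ' f hf
    rw [hsum, map_sum]
    refine Finset.sum_eq_zero fun i _ => ?_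
    have hwP : (permGL (Equiv.swap 0 (Fin.castSucc i)) : GL (Fin (n + 2)) F) ∈ standardParabolicGL F (lastBlockLabel (n + 2)) := by
      refine permGL_mem_standardParabolicGL _ fun j => le_of_eq ?_
      have hfix : Equiv.swap (0 : Fin (n + 2)) (Fin.castSucc i) (Fin.last (n + 1)) = Fin.last (n + 1) :=
        Equiv.swap_apply_of_ne_of_ne (Fin.last_pos'.ne') (Fin.castSucc_lt_last i).ne'
      have key : ∀ j : Fin (n + 2), lastBlockLabel (n + 2) j = decide (j = Fin.last (n + 1)) := by
        intro j
        simp only [lastBlockLabel, Fin.ext_iff, Fin.val_last]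
        by_cases h : (j : ℕ) = n + 1
        · rw [decide_eq_true h, decide_eq_true (by omega)]
        · rw [decide_eq_false h, decide_eq_false (by have := j.2; omega)]
      rw [key, key]
      congr 1
      rw [← hfix, Equiv.apply_eq_iff_eq, hfix]
    rw [hlamP ⟨_, hwP⟩, hopen _ (hfi i), mul_zero]
  -- Step 3: `λ = c · ev₁`
  have hev : ∃ c : ℂ, ∀ f : Representation.SmoothInd (standardParabolicGL F (lastBlockLabel (n + 2))) σ', lam f = c * f.toFun 1 := by
    by_cases h : ∃ f₁ : Representation.SmoothInd (standardParabolicGL F (lastBlockLabel (n + 2))) σ', f₁.toFun 1 ≠ 0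
    · obtain ⟨f₁, hf₁⟩ := h
      refine ⟨lam f₁ / f₁.toFun 1, fun f => ?_⟩
      have hval : ∀ (h : Representation.SmoothInd (standardParabolicGL F (lastBlockLabel (n + 2))) σ') {p : GL (Fin (n + 2)) F} (hp : p ∈ standardParabolicGL F (lastBlockLabel (n + 2))),
          h.toFun p = σ' ⟨p, hp⟩ 1 * h.toFun 1 := by
        intro h p hp
        rw [← apply_eq_mul_apply_one, ← Representation.SmoothInd.toFun_subgroup_mul, mul_one]
      have hg : ∀ p ∈ standardParabolicGL F (lastBlockLabel (n + 2)),
          (f - (f.toFun 1 / f₁.toFun 1) • f₁).toFun p = 0 := by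
        intro p hp
        have e1 : (f - (f.toFun 1 / f₁.toFun 1) • f₁).toFun =
            f.toFun - (f.toFun 1 / f₁.toFun 1) • f₁.toFun := by
          rw [← Representation.SmoothInd.toFunₗ_apply, map_sub, map_smul, Representation.SmoothInd.toFunₗ_apply,
            Representation.SmoothInd.toFunₗ_apply]
        rw [e1, Pi.sub_apply, Pi.smul_apply, smul_eq_mul, hval f hp, hval f₁ hp, ← mul_assoc,
          mul_comm (f.toFun 1 / f₁.toFun 1), mul_assoc, div_mul_cancel₀ _ hf₁, sub_self]
      have := hclosed _ hg
      rw [map_sub, map_smul, smul_eq_mul, sub_eq_zero] at this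
      rw [this, div_mul_eq_mul_div, mul_comm, ← div_mul_eq_mul_div, mul_comm]
    · refine ⟨0, fun f => ?_⟩
      rw [zero_mul]
      refine hclosed f fun p hp => ?_
      rw [← mul_one p, show p * 1 = ((⟨p, hp⟩ : ↥(standardParabolicGL F (lastBlockLabel (n + 2)))) : GL (Fin (n + 2)) F) * 1 from rfl,
        Representation.SmoothInd.toFun_subgroup_mul]
      have h0 : f.toFun 1 = 0 := by
        by_contra h0; exact h ⟨f, h0⟩
      rw [h0, map_zero]
  -- Step 4: `T = c · id`
  obtain ⟨c, hc⟩ := hev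
  refine ⟨c, fun f => Representation.SmoothInd.ext (funext fun g => ?_)⟩
  rw [hTval, hc, Representation.toFun_smoothIndRep_apply, one_mul, Representation.SmoothInd.toFun_smul,
    Pi.smul_apply, smul_eq_mul]

/-- **Irreducibility from `End = ℂ` and complete reducibility.** If every intertwining operator of a
representation `ρ` is a scalar, every subrepresentation has an invariant complement, and the space is
non-zero, then `ρ` is irreducible. [cite: BernsteinZelevinskyASENS1977, Thm. 5.2 and §7.1] -/
theorem isIrreducible_of_forall_intertwiningMap_of_exists_isCompl {G V : Type*} [Group G] [AddCommGroup V]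
    [Module ℂ V] [Nontrivial V] (ρ : Representation ℂ G V)
    (hEnd : ∀ T : ρ.IntertwiningMap ρ, ∃ c : ℂ, ∀ v, T v = c • v)
    (hcr : ∀ W : Subrepresentation ρ, ∃ W' : Subrepresentation ρ, IsCompl W.toSubmodule W'.toSubmodule) :
    ρ.IsIrreducible := by
  classical
  haveI : Nontrivial (Subrepresentation ρ) :=
    ⟨⟨⊥, ⊤, fun h => bot_ne_top (congrArg Subrepresentation.toSubmodule h :
      ((⊥ : Subrepresentation ρ).toSubmodule) = (⊤ : Subrepresentation ρ).toSubmodule)⟩⟩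
  refine IsSimpleOrder.mk fun W => ?_
  obtain ⟨W', hc⟩ := hcr W
  -- the projection onto `W` along `W'` is an intertwining operator
  set E : V →ₗ[ℂ] V := W.toSubmodule.projection W'.toSubmodule hc with hE
  have hEρ : ∀ g v, E (ρ g v) = ρ g (E v) := by
    intro g v
    have hv := Submodule.projection_add_projection_eq_self hc v
    conv_lhs => rw [← hv]
    rw [map_add, map_add]
    have h1 : ρ g (W.toSubmodule.projection W'.toSubmodule hc v) ∈ W.toSubmodule :=
      W.apply_mem_toSubmodule g (Submodule.projection_apply_mem hc v)
    have h2 : ρ g (W'.toSubmodule.projection W.toSubmodule hc.symm v) ∈ W'.toSubmodule :=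
      W'.apply_mem_toSubmodule g (Submodule.projection_apply_mem hc.symm v)
    rw [hE, Submodule.projection_apply_of_mem_left hc h1]
    have h3 : W.toSubmodule.projection W'.toSubmodule hc (ρ g (W'.toSubmodule.projection W.toSubmodule hc.symm v)) = 0 := by
      have := Submodule.projection_eq_self_sub_projection hc.symm
        (ρ g (W'.toSubmodule.projection W.toSubmodule hc.symm v))
      rw [Submodule.projection_apply_of_mem_left hc.symm h2, sub_self] at this
      exact this
    rw [h3, add_zero]
  obtain ⟨c, hc'⟩ := hEnd (LinearMap.intertwiningMap_of_isIntertwiningMap (ρ := ρ) (σ := ρ) E hEρ)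
  have hEc : ∀ v, E v = c • v := hc'
  by_cases hW : W = ⊥
  · exact Or.inl hW
  · right
    -- `c = 1`, so `E = id` and `W = ⊤`
    obtain ⟨w, hw, hw0⟩ : ∃ w ∈ W.toSubmodule, w ≠ 0 := by
      by_contra h
      exact hW (Subrepresentation.toSubmodule_injective ((Submodule.eq_bot_iff _).2 fun w hw => by
        by_contra hw0; exact h ⟨w, hw, hw0⟩))
    have hc1 : c = 1 := by
      have h := hEc w
      rw [hE, Submodule.projection_apply_of_mem_left hc hw] at h
      by_contra hc1
      have h2 : (1 - c) • w = 0 := by rw [sub_smul, one_smul, ← h, sub_self]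
      exact hw0 ((smul_eq_zero.1 h2).resolve_left (sub_ne_zero.2 (Ne.symm hc1)))
    apply Subrepresentation.toSubmodule_injective
    change W.toSubmodule = ⊤
    rw [eq_top_iff]
    intro v _
    have := hEc v
    rw [hc1, one_smul] at this
    rw [← this]
    exact Submodule.projection_apply_mem hc v

/-- **`End_{GL_N}(Ind_{Q_{N-1,1}}^{GL_N} σ') = ℂ` from the open cell alone** (the irregular-case entry
point): for ANY one-dimensional `σ'` of `P = Q_{N-1,1}`, an intertwining operator `T` of
`I = Ind_P^{GL_N} σ'` whose functional `λ f = (T f)(1)` kills the open-cell part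
`I_open = {f : f = 0 on the closed cells}` is a scalar. (Steps 2–4 of
`exists_intertwiningMap_eq_smul`: `λ` then kills every `f` vanishing on `P` by the chart decomposition
`exists_sum_smoothIndRep_swap_of_forall_toFun_eq_zero`, hence `λ = c · ev₁` and `T = c`.) In the regular
case Step 1 supplies the hypothesis from distinct exponents; in the irregular case
`N = 2, ν₀ = χ′` it comes from a non-semisimplicity witness in the Jacquet module instead.
[cite: BernsteinZelevinskyASENS1977, Thm. 5.2 and §7.1] -/
theorem exists_intertwiningMap_eq_smul_of_forall_vanishingOn
    (T : (Representation.smoothIndRep (standardParabolicGL F (lastBlockLabel (n + 2))) σ').IntertwiningMap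
      (Representation.smoothIndRep (standardParabolicGL F (lastBlockLabel (n + 2))) σ'))
    (hopen : ∀ f : Representation.SmoothInd (standardParabolicGL F (lastBlockLabel (n + 2))) σ',
      f ∈ vanishingOn (standardParabolicGL F (lastBlockLabel (n + 2))) σ'
        (cellLT (K := F) (lastBlockLabel (n + 2)) Fin.revPerm) → (T f).toFun 1 = 0) :
    ∃ c : ℂ, ∀ f, T f = c • f := by
  classical
  -- the functional `λ f = (T f)(1)` and its `(P, σ')`-equivariance
  set lam : Representation.SmoothInd (standardParabolicGL F (lastBlockLabel (n + 2))) σ' →ₗ[ℂ] ℂ :=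
    (LinearMap.proj (1 : GL (Fin (n + 2)) F)) ∘ₗ
      (Representation.SmoothInd.toFunₗ (standardParabolicGL F (lastBlockLabel (n + 2))) σ' ∘ₗ T.toLinearMap)
    with hlam_def
  have hlam : ∀ f, lam f = (T f).toFun 1 := fun f => rfl
  have hT : ∀ (g : GL (Fin (n + 2)) F) (f : Representation.SmoothInd (standardParabolicGL F (lastBlockLabel (n + 2))) σ'), T ((Representation.smoothIndRep (standardParabolicGL F (lastBlockLabel (n + 2))) σ') g f) = (Representation.smoothIndRep (standardParabolicGL F (lastBlockLabel (n + 2))) σ') g (T f) := fun g f => by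
    have := LinearMap.congr_fun (T.isIntertwining' g) f
    exact this
  have hTval : ∀ (g : GL (Fin (n + 2)) F) (f : Representation.SmoothInd (standardParabolicGL F (lastBlockLabel (n + 2))) σ'), (T f).toFun g = lam ((Representation.smoothIndRep (standardParabolicGL F (lastBlockLabel (n + 2))) σ') g f) := by
    intro g f
    rw [hlam, hT, Representation.toFun_smoothIndRep_apply, one_mul]
  have hlamP : ∀ (p : ↥(standardParabolicGL F (lastBlockLabel (n + 2)))) (f : Representation.SmoothInd (standardParabolicGL F (lastBlockLabel (n + 2))) σ'), lam ((Representation.smoothIndRep (standardParabolicGL F (lastBlockLabel (n + 2))) σ') (p : GL (Fin (n + 2)) F) f) = σ' p 1 * lam f := by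
    intro p f
    rw [hlam, hlam, hT, Representation.toFun_smoothIndRep_apply, one_mul, ← mul_one (p : GL (Fin (n + 2)) F),
      Representation.SmoothInd.toFun_subgroup_mul, apply_eq_mul_apply_one]
  have hopen' : ∀ f : Representation.SmoothInd (standardParabolicGL F (lastBlockLabel (n + 2))) σ', f ∈ vanishingOn (standardParabolicGL F (lastBlockLabel (n + 2))) σ'
      (cellLT (K := F) (lastBlockLabel (n + 2)) Fin.revPerm) → lam f = 0 := fun f hf => by
    rw [hlam]; exact hopen f hf
  -- `λ` kills every `f` vanishing on `P` (chart decomposition)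
  have hclosed : ∀ f : Representation.SmoothInd (standardParabolicGL F (lastBlockLabel (n + 2))) σ', (∀ p ∈ standardParabolicGL F (lastBlockLabel (n + 2)), f.toFun p = 0) → lam f = 0 := by
    intro f hf
    obtain ⟨fi, hfi, hsum⟩ := exists_sum_smoothIndRep_swap_of_forall_toFun_eq_zero σ' f hf
    rw [hsum, map_sum]
    refine Finset.sum_eq_zero fun i _ => ?_
    have hwP : (permGL (Equiv.swap 0 (Fin.castSucc i)) : GL (Fin (n + 2)) F) ∈ standardParabolicGL F (lastBlockLabel (n + 2)) := by
      refine permGL_mem_standardParabolicGL _ fun j => le_of_eq ?_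
      have hfix : Equiv.swap (0 : Fin (n + 2)) (Fin.castSucc i) (Fin.last (n + 1)) = Fin.last (n + 1) :=
        Equiv.swap_apply_of_ne_of_ne (Fin.last_pos'.ne') (Fin.castSucc_lt_last i).ne'
      have key : ∀ j : Fin (n + 2), lastBlockLabel (n + 2) j = decide (j = Fin.last (n + 1)) := by
        intro j
        simp only [lastBlockLabel, Fin.ext_iff, Fin.val_last]
        by_cases h : (j : ℕ) = n + 1
        · rw [decide_eq_true h, decide_eq_true (by omega)]
        · rw [decide_eq_false h, decide_eq_false (by have := j.2; omega)]
      rw [key, key]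
      congr 1
      rw [← hfix, Equiv.apply_eq_iff_eq, hfix]
    rw [hlamP ⟨_, hwP⟩, hopen' _ (hfi i), mul_zero]
  -- `λ = c · ev₁`
  have hev : ∃ c : ℂ, ∀ f : Representation.SmoothInd (standardParabolicGL F (lastBlockLabel (n + 2))) σ', lam f = c * f.toFun 1 := by
    by_cases h : ∃ f₁ : Representation.SmoothInd (standardParabolicGL F (lastBlockLabel (n + 2))) σ', f₁.toFun 1 ≠ 0
    · obtain ⟨f₁, hf₁⟩ := h
      refine ⟨lam f₁ / f₁.toFun 1, fun f => ?_⟩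
      have hval : ∀ (h : Representation.SmoothInd (standardParabolicGL F (lastBlockLabel (n + 2))) σ') {p : GL (Fin (n + 2)) F} (hp : p ∈ standardParabolicGL F (lastBlockLabel (n + 2))),
          h.toFun p = σ' ⟨p, hp⟩ 1 * h.toFun 1 := by
        intro h p hp
        rw [← apply_eq_mul_apply_one, ← Representation.SmoothInd.toFun_subgroup_mul, mul_one]
      have hg : ∀ p ∈ standardParabolicGL F (lastBlockLabel (n + 2)),
          (f - (f.toFun 1 / f₁.toFun 1) • f₁).toFun p = 0 := by
        intro p hp
        have e1 : (f - (f.toFun 1 / f₁.toFun 1) • f₁).toFun =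
            f.toFun - (f.toFun 1 / f₁.toFun 1) • f₁.toFun := by
          rw [← Representation.SmoothInd.toFunₗ_apply, map_sub, map_smul, Representation.SmoothInd.toFunₗ_apply,
            Representation.SmoothInd.toFunₗ_apply]
        rw [e1, Pi.sub_apply, Pi.smul_apply, smul_eq_mul, hval f hp, hval f₁ hp, ← mul_assoc,
          mul_comm (f.toFun 1 / f₁.toFun 1), mul_assoc, div_mul_cancel₀ _ hf₁, sub_self]
      have := hclosed _ hg
      rw [map_sub, map_smul, smul_eq_mul, sub_eq_zero] at this
      rw [this, div_mul_eq_mul_div, mul_comm, ← div_mul_eq_mul_div, mul_comm]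
    · refine ⟨0, fun f => ?_⟩
      rw [zero_mul]
      refine hclosed f fun p hp => ?_
      rw [← mul_one p, show p * 1 = ((⟨p, hp⟩ : ↥(standardParabolicGL F (lastBlockLabel (n + 2)))) : GL (Fin (n + 2)) F) * 1 from rfl,
        Representation.SmoothInd.toFun_subgroup_mul]
      have h0 : f.toFun 1 = 0 := by
        by_contra h0; exact h ⟨f, h0⟩
      rw [h0, map_zero]
  -- `T = c · id`
  obtain ⟨c, hc⟩ := hev
  refine ⟨c, fun f => Representation.SmoothInd.ext (funext fun g => ?_)⟩
  rw [hTval, hc, Representation.toFun_smoothIndRep_apply, one_mul, Representation.SmoothInd.toFun_smul,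
    Pi.smul_apply, smul_eq_mul]

end Literature.NumberTheory.Automorphic.Zelevinsky1980

end
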